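import Mathlib
import Summits.NavierStokesRegularity.OSWSelfSimilar.SheetRowThirdHilbert
import Summits.NavierStokesRegularity.OSWSelfSimilar.SheetRowThirdInviscidBlowup
import HarnessLib

/-!
# Faithfulness check of the half-line identity (★) on the kernel exact row `c_l = 1/3`:
# with the GENUINE Hilbert transform, (★) holds on the dilated double-pole ansatz IFF the width law `ℓ²(1−2a) = 9εa`

HONEST FRAMING (cell ns-blowup GROUP B «PROFILE SEARCH», zone Z3 = the 1-D viscous gCLM/OSW sheet; human rulings
D-0035/D-0074): **1-D MODEL; closed-form calculus kernel-checked; not Euler, not Navier–Stokes; «violates: none — MODEL».**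

PURPOSE (the lead's T-list item (t5) for `SheetHalfLineIdentity`, RULING (fc)(3)): re-derive, in the kernel and with the genuine
`hilbertTransform` of `Literature/Analysis/Fourier/HilbertTransformLine.lean`, the three terms of the half-line identity
  `(c_ω − c_l)∫₀^∞ Ω − (1 + a)∫₀^∞ (HΩ)Ω + ε Ω′(0) = 0`                                                  (★)
(`SheetHalfLine.halfLine_identity_gCLM`, `c_ω = 1`) on the exact row `c_l = 1/3` of SHEET-ℝ
(`SheetRowThirdExactFamily` / `SheetRowThirdHilbert`: `Ω(η) = −A f(η/ℓ)`, `f(x) = x/(1+x²)²`, `A = 8/(3a)`, `HΩ(ξ) = −A (Hf)(ξ/ℓ)`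
with `Hf = (x²−1)/(2(1+x²)²)` = `hilbertTransform_profile`), and confirm that (★) is EQUIVALENT on that ansatz to the width law
`ℓ²(1 − 2a) = 9εa` of `rowResidual_third_eq_zero` — i.e. the one-line test (★) detects exactly the kernel row.

* `integral_Ioi_profile` — `∫₀^∞ x/(1+x²)² dx = 1/2` (primitive `−1/(2(1+x²))`);
* `integral_Ioi_hilbProfile_mul_profile` — `∫₀^∞ (Hf)·f = −1/24` (primitive `(1 − 3x²)/(24(1+x²)³)`);
* `integral_Ioi_dilatedProfile`, `integral_Ioi_dilatedPairing` — the dilated values `−Aℓ/2`, `−A²ℓ/24`;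
* `halfLine_thirdRow_iff_width` — **(★) on the ansatz ⇔ `ℓ²(1−2a) = 9εa`** (the left side equals
  `(A/(9aℓ))·(ℓ²(1−2a) − 9εa)`), with `HΩ = hilbertTransform Ω` and `Ω′(0) = deriv Ω 0 = −A/ℓ`.
So the sign conventions of (★) (in particular the `−(1+a)` in front of the stretching pairing, and `∫₀^∞(HΩ)Ω < 0` here:
`−A²ℓ/24`) agree with an exact sheet point carrying the real Hilbert transform. No definitions, no hypotheses of `Prop` type.
bears_on: LADDER-NS N5 / Z3 clause (i′) audit (t5) → N1 linear core. WHAT THIS IS NOT: not NS; not a new sheet point.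
-/

noncomputable section
open Set Filter Topology MeasureTheory

namespace Summit.NavierStokesRegularity.OSWSelfSimilar
namespace SheetHalfLine
open SheetRowThirdExactFamily Literature.Analysis.Fourier

/-! ### Two closed-form half-line integrals of the double-pole profile -/

/-- `f = x/(1+x²)²` is integrable. [folklore] -/
theorem integrable_profile : Integrable profile := by
  simpa [one_mul] using integrable_scaledProfile 1

/-- **`∫₀^∞ x/(1+x²)² dx = 1/2`** (primitive `−1/(2(1+x²)) → 0`, value `−1/2` at `0`). [folklore] -/
theorem integral_Ioi_profile : ∫ x in Ioi (0:ℝ), profile x = 1 / 2 := by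
  have hd : ∀ x ∈ Ioi (0:ℝ), HasDerivAt (fun y : ℝ => -1 / 2 * (1 + y ^ 2)⁻¹) (profile x) x := by
    intro x _
    have hpos : (1 + x ^ 2) ≠ 0 := by positivity
    have h := ((hasDerivAt_one_add_sq x).inv hpos).const_mul (-1 / 2)
    refine h.congr_deriv ?_
    unfold profile
    field_simp
  have hc : ContinuousWithinAt (fun y : ℝ => -1 / 2 * (1 + y ^ 2)⁻¹) (Ici 0) 0 :=
    (((hasDerivAt_one_add_sq 0).inv (by positivity)).const_mul (-1 / 2)).continuousAt.continuousWithinAt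
  have hlim : Tendsto (fun y : ℝ => -1 / 2 * (1 + y ^ 2)⁻¹) atTop (𝓝 0) := by
    have h1 : Tendsto (fun y : ℝ => 1 + y ^ 2) atTop atTop :=
      tendsto_const_nhds.add_atTop (tendsto_pow_atTop two_ne_zero)
    have h2 := (h1.inv_tendsto_atTop).const_mul (-1 / 2 : ℝ)
    simpa using h2
  rw [integral_Ioi_of_hasDerivAt_of_tendsto hc hd integrable_profile.integrableOn hlim]
  norm_num

/-- Continuity of the closed-form Hilbert transform `Hf = (x²−1)/(2(1+x²)²)`. [folklore] -/
theorem continuous_hilbProfile : Continuous hilbProfile := by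
  unfold hilbProfile
  exact ((continuous_id.pow 2).sub continuous_const).div
    (continuous_const.mul ((continuous_const.add (continuous_id.pow 2)).pow 2)) (fun x => by positivity)

/-- `|Hf| ≤ 1/2`. [folklore] -/
theorem abs_hilbProfile_le (x : ℝ) : |hilbProfile x| ≤ 1 / 2 := by
  unfold hilbProfile
  have hpos : 0 < 2 * (1 + x ^ 2) ^ 2 := by positivity
  rw [abs_div, abs_of_pos hpos, div_le_div_iff₀ hpos (by norm_num : (0:ℝ) < 2)]
  have h1 : |x ^ 2 - 1| ≤ x ^ 2 + 1 := by
    rw [abs_le]; constructor <;> nlinarith [sq_nonneg x]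
  nlinarith [sq_nonneg x, sq_nonneg (x ^ 2)]

/-- `(Hf)·f` is integrable. [folklore] -/
theorem integrable_hilbProfile_mul_profile : Integrable fun x => hilbProfile x * profile x := by
  refine Integrable.mono' ((integrable_profile.norm).const_mul (1 / 2))
    ((continuous_hilbProfile.mul (contDiff_scaledProfile 1 |>.continuous.congr (fun x => by simp))).aestronglyMeasurable)
    (Eventually.of_forall fun x => ?_)
  rw [norm_mul, Real.norm_eq_abs, Real.norm_eq_abs]
  exact mul_le_mul_of_nonneg_right (abs_hilbProfile_le x) (abs_nonneg _)

/-- **`∫₀^∞ (Hf)(x) f(x) dx = −1/24`** (integrand `x(x²−1)/(2(1+x²)⁴)`, primitive `(1 − 3x²)/(24(1+x²)³) → 0`, value `1/24` at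
`0`). The half-line stretching pairing of the inviscid double-pole profile is NEGATIVE, as `SheetHalfLineHilbertSign` says it must
be. [folklore] -/
theorem integral_Ioi_hilbProfile_mul_profile : ∫ x in Ioi (0:ℝ), hilbProfile x * profile x = -1 / 24 := by
  have hd : ∀ x ∈ Ioi (0:ℝ),
      HasDerivAt (fun y : ℝ => (1 - 3 * y ^ 2) / (24 * (1 + y ^ 2) ^ 3)) (hilbProfile x * profile x) x := by
    intro x _
    have hpos : (24 * (1 + x ^ 2) ^ 3) ≠ 0 := by positivity
    have hsq : HasDerivAt (fun y : ℝ => y ^ 2) (2 * x) x := by simpa using hasDerivAt_pow 2 x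
    have hnum : HasDerivAt (fun y : ℝ => 1 - 3 * y ^ 2) (-(3 * (2 * x))) x := (hsq.const_mul 3).const_sub 1
    have hden : HasDerivAt (fun y : ℝ => 24 * (1 + y ^ 2) ^ 3) (24 * (3 * (1 + x ^ 2) ^ 2 * (2 * x))) x := by
      have h := ((hasDerivAt_one_add_sq x).pow 3).const_mul 24
      refine h.congr_deriv ?_
      simp only [Nat.cast_ofNat, Nat.reduceSub]
    have h := hnum.div hden hpos
    refine h.congr_deriv ?_
    unfold hilbProfile profile
    field_simp
    ring
  have hc : ContinuousWithinAt (fun y : ℝ => (1 - 3 * y ^ 2) / (24 * (1 + y ^ 2) ^ 3)) (Ici 0) 0 := by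
    refine Continuous.continuousWithinAt ?_
    exact (continuous_const.sub (continuous_const.mul (continuous_id.pow 2))).div
      (continuous_const.mul ((continuous_const.add (continuous_id.pow 2)).pow 3)) (fun x => by positivity)
  have hlim : Tendsto (fun y : ℝ => (1 - 3 * y ^ 2) / (24 * (1 + y ^ 2) ^ 3)) atTop (𝓝 0) := by
    -- |(1 − 3y²)/(24(1+y²)³)| ≤ (1+y²)⁻¹
    have h1 : Tendsto (fun y : ℝ => 1 + y ^ 2) atTop atTop :=
      tendsto_const_nhds.add_atTop (tendsto_pow_atTop two_ne_zero)
    have h2 : Tendsto (fun y : ℝ => (1 + y ^ 2)⁻¹) atTop (𝓝 0) := h1.inv_tendsto_atTop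
    refine squeeze_zero_norm (fun y => ?_) h2
    have hq : 0 < 1 + y ^ 2 := by positivity
    rw [Real.norm_eq_abs, abs_div, abs_of_pos (by positivity : (0:ℝ) < 24 * (1 + y ^ 2) ^ 3),
      div_le_iff₀ (by positivity)]
    have h3 : |1 - 3 * y ^ 2| ≤ 3 * (1 + y ^ 2) := by
      rw [abs_le]; constructor <;> nlinarith [sq_nonneg y]
    have h4 : (1 + y ^ 2)⁻¹ * (24 * (1 + y ^ 2) ^ 3) = 24 * (1 + y ^ 2) ^ 2 := by
      field_simp
    rw [h4]
    nlinarith [sq_nonneg y, sq_nonneg (y ^ 2)]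
  rw [integral_Ioi_of_hasDerivAt_of_tendsto hc hd integrable_hilbProfile_mul_profile.integrableOn hlim]
  norm_num

/-! ### The dilated family `Ω(η) = −A f(η/ℓ)` -/

/-- `∫₀^∞ (−A f(η/ℓ)) dη = −Aℓ/2` for `ℓ > 0`. [folklore] -/
theorem integral_Ioi_dilatedProfile (A : ℝ) {ℓ : ℝ} (hℓ : 0 < ℓ) :
    ∫ η in Ioi (0:ℝ), -A * profile (η / ℓ) = -(A * ℓ) / 2 := by
  have h := integral_comp_mul_left_Ioi (fun x => -A * profile x) 0 (inv_pos.mpr hℓ)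
  simp only [mul_zero, inv_inv, smul_eq_mul] at h
  have e : ∫ η in Ioi (0:ℝ), -A * profile (η / ℓ) = ∫ x in Ioi (0:ℝ), -A * profile (ℓ⁻¹ * x) :=
    setIntegral_congr_fun measurableSet_Ioi fun x _ => by rw [div_eq_inv_mul]
  rw [e, h, integral_const_mul, integral_Ioi_profile]
  ring

/-- `∫₀^∞ (−A (Hf)(η/ℓ))·(−A f(η/ℓ)) dη = −A²ℓ/24` for `ℓ > 0`. [folklore] -/
theorem integral_Ioi_dilatedPairing (A : ℝ) {ℓ : ℝ} (hℓ : 0 < ℓ) :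
    ∫ η in Ioi (0:ℝ), (-A * hilbProfile (η / ℓ)) * (-A * profile (η / ℓ)) = -(A ^ 2 * ℓ) / 24 := by
  have h := integral_comp_mul_left_Ioi (fun x => (-A * hilbProfile x) * (-A * profile x)) 0 (inv_pos.mpr hℓ)
  simp only [mul_zero, inv_inv, smul_eq_mul] at h
  have e : ∫ η in Ioi (0:ℝ), (-A * hilbProfile (η / ℓ)) * (-A * profile (η / ℓ))
      = ∫ x in Ioi (0:ℝ), (-A * hilbProfile (ℓ⁻¹ * x)) * (-A * profile (ℓ⁻¹ * x)) :=
    setIntegral_congr_fun measurableSet_Ioi fun x _ => by rw [div_eq_inv_mul]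
  have e2 : ∫ x in Ioi (0:ℝ), (-A * hilbProfile x) * (-A * profile x) = A ^ 2 * ∫ x in Ioi (0:ℝ), hilbProfile x * profile x := by
    rw [← integral_const_mul]
    refine setIntegral_congr_fun measurableSet_Ioi fun x _ => ?_
    ring
  rw [e, h, e2, integral_Ioi_hilbProfile_mul_profile]
  ring

/-! ### (★) on the exact row ⇔ the width law -/

/-- **FAITHFULNESS OF (★) ON THE KERNEL ROW `c_l = 1/3`.** For `a ≠ 0`, `ℓ > 0`, `A = 8/(3a)` and the dilated double-pole
ansatz `Ω(η) = −A f(η/ℓ)` with its GENUINE Hilbert transform (`hilbertTransform_dilatedProfile`), the left-hand side of the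
half-line identity at `(c_ω, c_l) = (1, 1/3)`,
`(1 − 1/3)∫₀^∞ Ω − (1 + a)∫₀^∞ (HΩ)Ω + ε Ω′(0)`  (`Ω′(0) = deriv Ω 0 = −A/ℓ`),
equals `(A/(9aℓ))·(ℓ²(1 − 2a) − 9εa)`; hence it VANISHES IFF the width law `ℓ²(1−2a) = 9εa` of
`SheetRowThirdExactFamily.rowResidual_third_eq_zero` holds — (★) alone detects the exact row. [new here — MODEL] -/
theorem halfLine_thirdRow_iff_width {a ε ℓ : ℝ} (ha : a ≠ 0) (hℓ : 0 < ℓ) :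
    (1 - 1 / 3) * (∫ η in Ioi (0:ℝ), -(8 / (3 * a)) * profile (η / ℓ))
        - (1 + a) * (∫ η in Ioi (0:ℝ), hilbertTransform (fun η => -(8 / (3 * a)) * profile (η / ℓ)) η
            * (-(8 / (3 * a)) * profile (η / ℓ)))
        + ε * deriv (fun η => -(8 / (3 * a)) * profile (η / ℓ)) 0 = 0
      ↔ ℓ ^ 2 * (1 - 2 * a) = 9 * ε * a := by
  have hℓ0 : ℓ ≠ 0 := hℓ.ne'
  have hH : ∫ η in Ioi (0:ℝ), hilbertTransform (fun η => -(8 / (3 * a)) * profile (η / ℓ)) η * (-(8 / (3 * a)) * profile (η / ℓ))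
      = ∫ η in Ioi (0:ℝ), (-(8 / (3 * a)) * hilbProfile (η / ℓ)) * (-(8 / (3 * a)) * profile (η / ℓ)) :=
    setIntegral_congr_fun measurableSet_Ioi fun η _ => by rw [hilbertTransform_dilatedProfile _ hℓ η]
  have hder : deriv (fun η => -(8 / (3 * a)) * profile (η / ℓ)) 0 = -(8 / (3 * a)) / ℓ := by
    rw [(hasDerivAt_dilatedProfile (8 / (3 * a)) hℓ0 0).deriv, zero_div, dProfile_zero, mul_one, neg_div]
  rw [hH, integral_Ioi_dilatedProfile _ hℓ, integral_Ioi_dilatedPairing _ hℓ, hder]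
  have key : (1 - 1 / 3) * (-(8 / (3 * a) * ℓ) / 2) - (1 + a) * (-((8 / (3 * a)) ^ 2 * ℓ) / 24)
      + ε * (-(8 / (3 * a)) / ℓ) = (8 / (3 * a)) / (9 * a * ℓ) * (ℓ ^ 2 * (1 - 2 * a) - 9 * ε * a) := by
    field_simp
    ring
  rw [key]
  have hcoef : (8 / (3 * a)) / (9 * a * ℓ) ≠ 0 := by positivity
  constructor
  · intro h
    rcases mul_eq_zero.mp h with h1 | h1
    · exact absurd h1 hcoef
    · linarith
  · intro h
    rw [show ℓ ^ 2 * (1 - 2 * a) - 9 * ε * a = 0 by linarith, mul_zero]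

/-- The same statement with the width law as HYPOTHESIS: on the kernel row (`ℓ²(1−2a) = 9εa`, `A = 8/(3a)`) the three terms of
(★) computed in closed form with the genuine Hilbert transform sum to zero: `−Aℓ/3 + (1+a)A²ℓ/24 − εA/ℓ = 0`. [new here — MODEL] -/
theorem halfLine_thirdRow_check {a ε ℓ : ℝ} (ha : a ≠ 0) (hℓ : 0 < ℓ) (hwidth : ℓ ^ 2 * (1 - 2 * a) = 9 * ε * a) :
    (1 - 1 / 3) * (∫ η in Ioi (0:ℝ), -(8 / (3 * a)) * profile (η / ℓ))
        - (1 + a) * (∫ η in Ioi (0:ℝ), hilbertTransform (fun η => -(8 / (3 * a)) * profile (η / ℓ)) η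
            * (-(8 / (3 * a)) * profile (η / ℓ)))
        + ε * deriv (fun η => -(8 / (3 * a)) * profile (η / ℓ)) 0 = 0 :=
  (halfLine_thirdRow_iff_width ha hℓ).mpr hwidth

end SheetHalfLine
end Summit.NavierStokesRegularity.OSWSelfSimilar
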